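import Mathlib
import HarnessLib
import HarnessLib.Audit.Tags

/-!
# HodgeLocusCensusFiniteHypergeometricAnchors — the exact layer behind ENGINE A-FF (cell pub-hlocus, abs-1 gen 7)
HONEST FRAMING: certified instances and evidence bearing on the general Hodge conjecture; no claim.

ENGINE A-FF (ABSHODGE.md `#### V3 — ENGINE A-FF`) recomputes, exactly and by a second seat, the finite
hypergeometric sums `H_p(t)`, `H_{p²}(t)` (and `H_{p³}(t)` for small `p`) of the four K3 pencils of CELL V3,
normalised as in Beukers–Cohen–Mellit (arXiv:1505.02900) Theorem 1.3, and re-derives the cell's three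
arithmetic layers from its own tables.  This file holds the small EXACT identities that computation rests on:

* the cyclotomic exponent data fed to BCM Thm 1.3: for `α = (a, ½, 1−a)`, `β = (1,1,1)` the identity
  `∏(X − e^{2πiα_j}) · ∏(X^{q_j} − 1) = ∏(X − e^{2πiβ_j}) · ∏(X^{p_i} − 1)` in `ℤ[X]` with
  `(p; q) = (4; 1,1,1,1)`, `(6; 3,1,1,1)`, `(3,2; 1⁵)`, `(2,2,2; 1⁶)` for `a = ¼, ⅙, ⅓, ½`, and the constants
  `M = ∏ p_i^{p_i} / ∏ q_j^{q_j} = 256, 1728, 108, 64` (= the `C` of the pencils, `t = C/X̄`);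
* the eigenvalue algebra turning the claimed characteristic polynomial
  `(T − ηp)(T² − (H_p − ηp)T + p²)`, `η = φ_p(1−t)` ([FR-V3-DET]) into the three tested identities
  `H_p² − H_{p²} = 2ηp·H_p`, `H_{p³} = H_p³ − 3ηp·H_p² + 3ηp³` (Newton), and conversely;
* the CM-fibre predictions of the `q = p²` layer: split `H_p = a + sp`, `H_{p²} = a² − p²`,
  `a² − 4p² = (π − π̄)²`; inert `H_p = sp`, `H_{p²} = 3p²`.
All statements are identities in commutative rings / `ℤ[X]` / `ℚ`; nothing here asserts a value of any `H_q`.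
-/
namespace Summit.HodgeConjecture.HodgeConjecture.HodgeLocus.Census

open Polynomial

/-! ## Cyclotomic exponent data of the four pencils (input to BCM Thm 1.3) -/

/-- Quartic Dwork pencil, `α = (¼, ½, ¾)`: `Φ₄Φ₂ · (X−1)⁴ = Φ₁³ · (X⁴ − 1)`, i.e. `(p; q) = (4; 1,1,1,1)`. -/
theorem cyclo_data_quartic :
    ((X ^ 2 + 1) * (X + 1) * (X - 1) ^ 4 : ℤ[X]) = (X - 1) ^ 3 * (X ^ 4 - 1) := by ring

/-- Sextic pencil, `α = (⅙, ½, ⅚)`: `Φ₆Φ₂ · (X³−1)(X−1)³ = Φ₁³ · (X⁶ − 1)`, i.e. `(p; q) = (6; 3,1,1,1)`. -/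
theorem cyclo_data_sextic :
    ((X ^ 2 - X + 1) * (X + 1) * ((X ^ 3 - 1) * (X - 1) ^ 3) : ℤ[X]) = (X - 1) ^ 3 * (X ^ 6 - 1) := by ring

/-- `X_(2,3)` pencil, `α = (⅓, ½, ⅔)`: `Φ₃Φ₂ · (X−1)⁵ = Φ₁³ · (X³−1)(X²−1)`, i.e. `(p; q) = (3,2; 1,1,1,1,1)`. -/
theorem cyclo_data_ci23 :
    ((X ^ 2 + X + 1) * (X + 1) * (X - 1) ^ 5 : ℤ[X]) = (X - 1) ^ 3 * ((X ^ 3 - 1) * (X ^ 2 - 1)) := by ring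

/-- `X_(2,2,2)` pencil, `α = (½, ½, ½)`: `Φ₂³ · (X−1)⁶ = Φ₁³ · (X²−1)³`, i.e. `(p; q) = (2,2,2; 1⁶)`. -/
theorem cyclo_data_ci222 :
    ((X + 1) ^ 3 * (X - 1) ^ 6 : ℤ[X]) = (X - 1) ^ 3 * (X ^ 2 - 1) ^ 3 := by ring

/-- The BCM constants `M = ∏ p_i^{p_i} / ∏ q_j^{q_j}` of the four data are the pencil constants
`C = 256, 1728, 108, 64` (so the BCM argument is `t = C/X̄`). -/
theorem bcm_M_constants :
    ((4:ℚ) ^ 4 = 256) ∧ ((6:ℚ) ^ 6 / 3 ^ 3 = 1728) ∧ ((3:ℚ) ^ 3 * 2 ^ 2 = 108) ∧ ((2:ℚ) ^ 2 * 2 ^ 2 * 2 ^ 2 = 64) := by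
  norm_num

/-- The BCM signs: `ε = (−1)^{Σ q_j} = +1, +1, −1, +1` and `(−1)^{r+s} = −1` for all four data
(`r + s = 5, 5, 7, 9`). -/
theorem bcm_signs :
    ((-1:ℤ) ^ (1+1+1+1) = 1) ∧ ((-1:ℤ) ^ (3+1+1+1) = 1) ∧ ((-1:ℤ) ^ (1+1+1+1+1) = -1) ∧ ((-1:ℤ) ^ (1+1+1+1+1+1) = 1)
    ∧ ((-1:ℤ) ^ (1+4) = -1) ∧ ((-1:ℤ) ^ (1+4) = -1) ∧ ((-1:ℤ) ^ (2+5) = -1) ∧ ((-1:ℤ) ^ (3+6) = -1) := by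
  norm_num

/-! ## The determinant law as identities on power sums
With Frobenius eigenvalues `p·u, p·v, η·p` (`u v = 1`, `η² = 1`) one has `H_{p^f} = (pu)^f + (pv)^f + (ηp)^f`. -/

section detlaw
variable {R : Type*} [CommRing R]

/-- `q = p²`: `H_p² − H_{p²} = 2ηp · H_p` (the form of [FR-V3-DET] tested by `derive_A.py`). -/
theorem detlaw_power_sum_two (p u v η : R) (huv : u * v = 1) (hη : η ^ 2 = 1) :
    (p*u + p*v + η*p) ^ 2 - ((p*u) ^ 2 + (p*v) ^ 2 + (η*p) ^ 2) = 2 * (η*p) * (p*u + p*v + η*p) := by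
  linear_combination (2 * p ^ 2) * huv - (2 * p ^ 2) * hη

/-- `q = p³` (Newton): `H_{p³} = H_p³ − 3ηp·H_p² + 3ηp³`. -/
theorem detlaw_power_sum_three (p u v η : R) (huv : u * v = 1) (hη : η ^ 2 = 1) :
    (p*u) ^ 3 + (p*v) ^ 3 + (η*p) ^ 3
      = (p*u + p*v + η*p) ^ 3 - 3 * (η*p) * (p*u + p*v + η*p) ^ 2 + 3 * η * p ^ 3 := by
  linear_combination (-(3 * p ^ 3) * (u + v)) * huv + (3 * p ^ 3 * (u + v) + 3 * η * p ^ 3) * hη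

/-- The characteristic polynomial with these roots is `(T − ηp)(T² − (H_p − ηp)T + p²)`. -/
theorem detlaw_charpoly (p u v η T : R) (huv : u * v = 1) :
    (T - p*u) * (T - p*v) * (T - η*p) = (T - η*p) * (T ^ 2 - ((p*u + p*v + η*p) - η*p) * T + p ^ 2) := by
  linear_combination (p ^ 2 * (T - η * p)) * huv

/-- Conversely, the two tested identities pin the elementary symmetric functions: if `e₁ = H_p`,
`H_p² − P₂ = 2ηp·e₁` and `P₃ = e₁³ − 3ηp e₁² + 3ηp³`, then Newton's identities give
`e₂ = ηp·e₁` and `e₃ = ηp³` — i.e. the characteristic polynomial `T³ − e₁T² + e₂T − e₃` equals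
`(T − ηp)(T² − (e₁ − ηp)T + p²)` (here over `ℚ`, where `2` and `3` are invertible; `η² = 1`). -/
theorem detlaw_converse (p η e₁ e₂ e₃ P₂ P₃ T : ℚ) (hη : η ^ 2 = 1)
    (newton2 : P₂ = e₁ ^ 2 - 2 * e₂) (newton3 : P₃ = e₁ ^ 3 - 3 * e₁ * e₂ + 3 * e₃)
    (h2 : e₁ ^ 2 - P₂ = 2 * (η*p) * e₁) (h3 : P₃ = e₁ ^ 3 - 3 * (η*p) * e₁ ^ 2 + 3 * η * p ^ 3) :
    e₂ = η*p*e₁ ∧ e₃ = η * p ^ 3 ∧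
    T ^ 3 - e₁ * T ^ 2 + e₂ * T - e₃ = (T - η*p) * (T ^ 2 - (e₁ - η*p) * T + p ^ 2) := by
  have he₂ : e₂ = η*p*e₁ := by linear_combination (1/2 : ℚ) * newton2 + (1/2 : ℚ) * h2
  have he₃ : e₃ = η * p ^ 3 := by
    linear_combination (-1/3 : ℚ) * newton3 + (1/3 : ℚ) * h3 + e₁ * he₂
  refine ⟨he₂, he₃, ?_⟩
  rw [he₂, he₃]
  linear_combination (p ^ 2 * T) * hη

end detlaw

/-! ## The `q = p²` CM-fibre predictions as identities -/

section cmlayer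
variable {R : Type*} [CommRing R]

/-- Split prime: eigenvalues `π, π̄, s·p` with `π π̄ = p²`, `s² = 1`, `a := π + π̄`:
`H_p = a + sp` and `H_{p²} = a² − p²`. -/
theorem cm_split_power_sums (p π πb s : R) (hn : π * πb = p ^ 2) (hs : s ^ 2 = 1) :
    (π + πb + s*p = (π + πb) + s*p) ∧ (π ^ 2 + πb ^ 2 + (s*p) ^ 2 = (π + πb) ^ 2 - p ^ 2) := by
  refine ⟨by ring, ?_⟩
  linear_combination (-2 : R) * hn + p ^ 2 * hs

/-- Split prime: `a² − 4p² = (π − π̄)²` — so `a² − 4p² = D₀ m²` says `π − π̄ = m√D₀`. -/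
theorem cm_split_discriminant (p π πb : R) (hn : π * πb = p ^ 2) :
    (π + πb) ^ 2 - 4 * p ^ 2 = (π - πb) ^ 2 := by
  linear_combination (4 : R) * hn

/-- Inert prime: eigenvalues `p, −p, s·p` (`s² = 1`): `H_p = sp` and `H_{p²} = 3p²`. -/
theorem cm_inert_power_sums (p s : R) (hs : s ^ 2 = 1) :
    (p + (-p) + s*p = s*p) ∧ (p ^ 2 + (-p) ^ 2 + (s*p) ^ 2 = 3 * p ^ 2) := by
  refine ⟨by ring, ?_⟩
  linear_combination p ^ 2 * hs

/-- Inert prime: the local factor is `(T − sp)(T − p)(T + p)`. -/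
theorem cm_inert_charpoly (p s T : R) :
    (T - s*p) * (T - p) * (T + p) = T ^ 3 - s*p * T ^ 2 - p ^ 2 * T + s * p ^ 3 := by ring

end cmlayer

/-! ## Two decidable anchors of the finite-field layer -/

/-- BCM Thm 1.2 at the smallest prime used: the Legendre curve `y² = x(x−1)(x−2)` over `𝔽₅` has
`7` affine points (so `8` projective points and `H_5(½,½;1,1 | 2) = −(8 − 6) = −2`, the value engine A-FF
returns). -/
theorem legendre_curve_F5_lambda2_affine_count :
    (Finset.univ.filter (fun xy : ZMod 5 × ZMod 5 => xy.2 ^ 2 = xy.1 * (xy.1 - 1) * (xy.1 - 2))).card = 7 := by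
  decide

/-- BCM Cor 1.6 at `p = 7`, `t = 2`: `x³ + 3x² − 8` has no root in `𝔽₇`,
so `N_f(2) = 0` and `H_7(⅓,⅔;1,½ | 2) = N_f(2) − 1 = −1`, the value engine A-FF returns. -/
theorem bcm_cubic_F7_t2_root_count :
    (Finset.univ.filter (fun x : ZMod 7 => x ^ 3 + 3 * x ^ 2 - 4 * 2 = 0)).card = 0 := by
  decide

end Summit.HodgeConjecture.HodgeConjecture.HodgeLocus.Census
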